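import Mathlib.Data.Real.Basic
import Mathlib.Tactic
import HarnessLib

/-!
# CriticalPhenomena/PercolationContinuityZ3 — Theorems/PercNearOneGluingNoHeavyPcintPolyCert.lean: a kernel-checkable certificate format for one-variable polynomial inequalities on a half-line

Lane prim-pcint, STRUCTURE rule (prim-pcint-2 GEN 18; infrastructure).  The dimension-uniform certificates of the memory automata
(…PcintMemUniformSix*: 50 row inequalities, each one polynomial in `d`) were discharged row by row with `ring` + `positivity`; the
memory-8 list has 289 rows, so here the same check is made COMPUTABLE: polynomials are coefficient lists over `ℤ` (ascending degree),
`peval p x` their value at a real `x`, and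

* `padd`, `psmul`, `pmul`, `ppow`, `psum` with `peval_padd` / `peval_psmul` / `peval_pmul` / `peval_ppow` / `peval_psum`;
* `pshift p c` = the coefficients of `p(X + c)` (`peval_pshift`);
* `allNonneg p` (all coefficients `≥ 0`) ⇒ `peval p x ≥ 0` for `x ≥ 0` (`peval_nonneg_of_allNonneg`); `posHead p` (constant coefficient
  `> 0`, rest `≥ 0`) ⇒ `peval p x > 0` for `x ≥ 0`;
* **`peval_nonneg_of_shift`** / **`peval_pos_of_shift`**: `allNonneg (pshift p c)` (resp. `posHead`) ⇒ `p(x) ≥ 0` (resp. `> 0`) for every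
  real `x ≥ c` — the "all Taylor coefficients at `c` are non-negative" certificate, decided by `decide`.
Consumer: …PcintMemUniformPolyCert (the memory-`τ` uniform certificates checked by ONE `decide`).

HONEST FRAMING: a 150-line verified checker; elementary.  No `sorry`; standard axioms.  Written by prim-pcint-2 gen 18
(prover-prim-pcint-2-g18-0), 2026-08-26.
-/

namespace Summit.CriticalPhenomena.PercolationContinuityZ3.Theorems.Pcint.PolyCert

/-- Value at `x : ℝ` of the integer coefficient list `p` (ascending degree, Horner). [folklore] -/
def peval : List ℤ → ℝ → ℝ
  | [], _ => 0
  | c :: cs, x => (c : ℝ) + x * peval cs x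

/-- `peval` of the empty list. [folklore] -/
@[simp] theorem peval_nil (x : ℝ) : peval [] x = 0 := rfl

/-- `peval` of a cons. [folklore] -/
@[simp] theorem peval_cons (c : ℤ) (cs : List ℤ) (x : ℝ) : peval (c :: cs) x = (c : ℝ) + x * peval cs x := rfl

/-- Sum of coefficient lists. [folklore] -/
def padd : List ℤ → List ℤ → List ℤ
  | [], q => q
  | p, [] => p
  | a :: p, b :: q => (a + b) :: padd p q

/-- `peval` is additive. [folklore] -/
theorem peval_padd : ∀ (p q : List ℤ) (x : ℝ), peval (padd p q) x = peval p x + peval q x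
  | [], q, x => by simp [padd]
  | a :: p, [], x => by simp [padd]
  | a :: p, b :: q, x => by
    simp only [padd, peval_cons, peval_padd p q x, Int.cast_add]
    ring

/-- Scalar multiple of a coefficient list. [folklore] -/
def psmul (c : ℤ) (p : List ℤ) : List ℤ := p.map (c * ·)

/-- `peval` of a scalar multiple. [folklore] -/
theorem peval_psmul (c : ℤ) : ∀ (p : List ℤ) (x : ℝ), peval (psmul c p) x = (c : ℝ) * peval p x
  | [], x => by simp [psmul]
  | a :: p, x => by
    have := peval_psmul c p x
    simp only [psmul, List.map_cons, peval_cons, Int.cast_mul] at this ⊢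
    rw [this]; ring

/-- Product of coefficient lists. [folklore] -/
def pmul : List ℤ → List ℤ → List ℤ
  | [], _ => []
  | a :: p, q => padd (psmul a q) (0 :: pmul p q)

/-- `peval` is multiplicative. [folklore] -/
theorem peval_pmul : ∀ (p q : List ℤ) (x : ℝ), peval (pmul p q) x = peval p x * peval q x
  | [], q, x => by simp [pmul]
  | a :: p, q, x => by
    rw [pmul, peval_padd, peval_psmul, peval_cons, peval_cons, peval_pmul p q x]
    push_cast
    ring

/-- Power of a coefficient list. [folklore] -/
def ppow (p : List ℤ) : ℕ → List ℤ
  | 0 => [1]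
  | n + 1 => pmul p (ppow p n)

/-- `peval` of a power. [folklore] -/
theorem peval_ppow (p : List ℤ) : ∀ (n : ℕ) (x : ℝ), peval (ppow p n) x = peval p x ^ n
  | 0, x => by simp [ppow]
  | n + 1, x => by rw [ppow, peval_pmul, peval_ppow p n x, pow_succ]; ring

/-- Sum of a list of coefficient lists. [folklore] -/
def psum : List (List ℤ) → List ℤ
  | [] => []
  | p :: ps => padd p (psum ps)

/-- `peval` of a list sum. [folklore] -/
theorem peval_psum : ∀ (ps : List (List ℤ)) (x : ℝ), peval (psum ps) x = (ps.map fun p => peval p x).sum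
  | [], x => by simp [psum]
  | p :: ps, x => by rw [psum, peval_padd, peval_psum ps x]; simp

/-- Taylor shift: the coefficients of `p(X + c)`. [folklore] -/
def pshift : List ℤ → ℤ → List ℤ
  | [], _ => []
  | a :: p, c => padd [a] (pmul [c, 1] (pshift p c))

/-- `peval (pshift p c) x = peval p (x + c)`. [folklore] -/
theorem peval_pshift : ∀ (p : List ℤ) (c : ℤ) (x : ℝ), peval (pshift p c) x = peval p (x + (c : ℝ))
  | [], c, x => by simp [pshift]
  | a :: p, c, x => by
    rw [pshift, peval_padd, peval_pmul, peval_pshift p c x]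
    simp only [peval_cons, peval_nil]
    push_cast
    ring

/-- All coefficients are non-negative. [folklore] -/
def allNonneg (p : List ℤ) : Bool := p.all fun c => decide (0 ≤ c)

/-- Non-negative coefficients give a non-negative value on `[0, ∞)`. [folklore] -/
theorem peval_nonneg_of_allNonneg : ∀ {p : List ℤ} (_ : allNonneg p = true) {x : ℝ} (_ : 0 ≤ x), 0 ≤ peval p x
  | [], _, x, _ => by simp
  | a :: p, h, x, hx => by
    simp only [allNonneg, List.all_cons, Bool.and_eq_true, decide_eq_true_eq] at h
    have ih := peval_nonneg_of_allNonneg (p := p) (by simpa [allNonneg] using h.2) hx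
    have ha : (0 : ℝ) ≤ (a : ℝ) := by exact_mod_cast h.1
    rw [peval_cons]
    nlinarith

/-- Constant coefficient positive, the rest non-negative. [folklore] -/
def posHead (p : List ℤ) : Bool :=
  match p with
  | [] => false
  | a :: cs => decide (0 < a) && allNonneg cs

/-- `posHead` gives a positive value on `[0, ∞)`. [folklore] -/
theorem peval_pos_of_posHead {p : List ℤ} (h : posHead p = true) {x : ℝ} (hx : 0 ≤ x) : 0 < peval p x := by
  cases p with
  | nil => simp [posHead] at h
  | cons a cs =>
    simp only [posHead, Bool.and_eq_true, decide_eq_true_eq] at h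
    have ih := peval_nonneg_of_allNonneg h.2 hx
    have ha : (0 : ℝ) < (a : ℝ) := by exact_mod_cast h.1
    rw [peval_cons]
    nlinarith

/-- **Half-line certificate**: if all Taylor coefficients of `p` at `c` are non-negative then `p(x) ≥ 0` for every `x ≥ c`. [folklore] -/
theorem peval_nonneg_of_shift {p : List ℤ} {c : ℤ} (h : allNonneg (pshift p c) = true) {x : ℝ} (hx : (c : ℝ) ≤ x) :
    0 ≤ peval p x := by
  have := peval_nonneg_of_allNonneg h (x := x - c) (by linarith)
  rwa [peval_pshift, sub_add_cancel] at this

/-- **Half-line certificate, strict**: `posHead (pshift p c)` gives `p(x) > 0` for every `x ≥ c`. [folklore] -/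
theorem peval_pos_of_shift {p : List ℤ} {c : ℤ} (h : posHead (pshift p c) = true) {x : ℝ} (hx : (c : ℝ) ≤ x) :
    0 < peval p x := by
  have := peval_pos_of_posHead h (x := x - c) (by linarith)
  rwa [peval_pshift, sub_add_cancel] at this

/-- The difference certificate: `allNonneg (pshift (padd q (psmul (-1) p)) c)` gives `p(x) ≤ q(x)` for `x ≥ c`. [folklore] -/
theorem peval_le_of_shift {p q : List ℤ} {c : ℤ} (h : allNonneg (pshift (padd q (psmul (-1) p)) c) = true) {x : ℝ}
    (hx : (c : ℝ) ≤ x) : peval p x ≤ peval q x := by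
  have := peval_nonneg_of_shift h hx
  rw [peval_padd, peval_psmul] at this
  push_cast at this
  linarith

end Summit.CriticalPhenomena.PercolationContinuityZ3.Theorems.Pcint.PolyCert
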